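import Summits.QuantumFields.YangMills.Theorems.SlowBitWindowStepPersistenceDressedSheet
import Summits.QuantumFields.YangMills.Theorems.SwapTwistDeficitTwistDeficitRungFixedL
import HarnessLib

/-!
# BC5 rung «r1» of `SlowBitWindow.StepPersistence` (item stmt-QuantumFields-23271) at EVERY FIXED LATTICE SIZE `L ≥ 2` — PROVED

`StepPersistence` (crux of route `SlowBitWindow`, D-0145 LINE g10-A of seat ym-idea-4; target K2a `ThermalTraceWindow.SubFemtoFirstLevel`) asks, uniformly on
the sub-femto window `L₀ ≤ L ≤ β^A`, for a bounded swap-odd physical observable `O` on `GaugeConfig 3 L SU2` whose one-step zero-flux thermal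
autocorrelation satisfies `β^{−k/L} · Z_phys(2L) ≤ insTrace L β O 1`.  Its cheapest falsifier (a) is the fixed-`L` instance «`β → ∞` at `L = 2` … must give
`≥ β^{−k/2}`; a decay like `exp(−cβ)` would kill the witness class».  This file proves the instance at EVERY fixed `L ≥ 2`, with a Polyakov-type witness:

* ★ `stepPersistence_rung_fixedL : ∀ L ≥ 2, ∃ k β₀, ∀ β ≥ β₀, ∃ O, IsPhys O ∧ |O| ≤ 1 ∧ O∘S = −O ∧ β^{−k/L} Z_phys(2L) ≤ insTrace L β O 1`,
  `O = g − g∘S` with `g = sheetTrial` (the `[0,1]`-valued physical function localised where the `x`-Polyakov holonomy is far from the centre and the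
  `y`-holonomy near it, `S` the spatial axis swap).

MECHANISM (spectral, ground-state-free — the vacuum is exponentially small near the sheet, so no bound through `e₀` could work):
* §1 the DRESSED witness `h = O·e^{−(β/2)S}`: `q_β(h,h) ≥ q_β(gw,gw) − 2q_β(gw,(g∘S)w) ≥ β^{−k}c_β^{|E|}` (`sheetTrial_dressed_gap`: box floor around the flat
  sheet configuration `…FlatSheetBox` + polynomial Haar ball volume, against the exponentially small cross term between `polDist`-separated supports);
* §2 the rung: `insTrace(O,1) ≥ c_β^{|E|} q_β(h,h)^{2L−1}/‖h‖^{2(2L−2)} ≥ c_β^{|E|} q_β(h,h)^{2L−1}` (`TT.insTrace_one_ge` of `…StepPersistenceMinorant`: rank-one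
  minorant of the transfer form + one eigen-data + tangent-line Jensen; `‖h‖² ≤ 1`), `c_β^{|E|} ≥ λ₀` (`topValue_le_latCE`) and `Z(2L) ≤ Cβ^qλ₀^{2L}`
  (`SwapTwistDeficit.physTrace_le_poly_mul_pow`) give `β^{−K} Z(2L) ≤ insTrace(O,1)`, `K = (2L−1)k + q + 1`, i.e. the statement with `k' = L·K`.

With this file all three trace-door cruxes of the K2a family (`TwistDeficit` 23317, K2 28257 / K2a 28291, `StepPersistence` 23271) have their fixed-`L`
rung.  HONEST FRAMING: a finite-dimensional variational witness at each fixed `L` (constants `k ∝ L⁴`, `β₀(L)` unbounded); NOT the crux (no uniformity along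
`L ≤ β^A`, no smearing, no small-ball estimate), no semiclassics/RG, nothing about infinite volume or the continuum; K2a, R2ξ″ and the Clay Yang–Mills gap
are untouched.  No `sorry`, no new axiom, no new definition.  References: [cite: MadrasSokal1988, §2]; [cite: ReedSimonIV1978, Thm. XIII.1];
[cite: ReedSimonI1980, Thm. VI.22–VI.23]; [cite: Luscher1983, §2]; [cite: SeilerLNP1982, §3]; [cite: MontvayMunster1994, (3.145)].
-/

set_option autoImplicit false

noncomputable section

open MeasureTheory Filter Topology Real Function
open scoped Matrix ComplexConjugate BigOperators
open Literature.MathematicalPhysics.QuantumLattice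
open Literature.MathematicalPhysics.QuantumFieldTheory hiding SU2
open Summit.QuantumFields.YangMills.Theorems

/-! ## §2 The rung -/

namespace Summit.QuantumFields.YangMills.Theorems.SlowBitWindow

open Summit.QuantumFields.YangMills.Theorems.FemtoTransferGap
open Summit.QuantumFields.YangMills.Theorems.FemtoTransferGap.FlatSheet

/-- ★ **`StepPersistence` at every fixed lattice size `L ≥ 2`** (rung r1 of item stmt-QuantumFields-23271, for all `L`): there are `k, β₀` such that
for every `β ≥ β₀` the bounded swap-ODD physical observable `O = g − g∘S` (`g` the sheet trial function: `|O| ≤ 1`, `O∘S = −O`) has one-step zero-flux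
thermal autocorrelation `insTrace L β O 1 ≥ β^{−k/L} · Z_phys(2L)` — the slow bit exists at every fixed `L` with a POWER-LAW (not exponential) floor,
so the route's cheapest falsifier (a) («a decay like `exp(−cβ)` would kill the witness class») is decided FOR the line at every lattice size.
Mechanism: `insTrace(O,1) ≥ c_β^{|E|} q_β(h,h)^{2L−1}/‖h‖^{2(2L−2)} ≥ c_β^{|E|} q_β(h,h)^{2L−1}` (`TT.insTrace_one_ge`, `‖h‖² ≤ 1`), `q_β(h,h) ≥ β^{−k}c_β^{|E|}`
(`sheetTrial_dressed_gap`), `c_β^{|E|} ≥ λ₀` and `Z(2L) ≤ Cβ^qλ₀^{2L}` (`SwapTwistDeficit.physTrace_le_poly_mul_pow`).  Constants blow up with `L`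
(`k ∝ L⁴`, `β₀(L)` unbounded): NOT the crux (no uniformity on `L ≤ β^A`). [cite: MadrasSokal1988, §2] [cite: ReedSimonIV1978, Thm. XIII.1] [cite: Luscher1983, §2] -/
theorem stepPersistence_rung_fixedL (L : ℕ) [NeZero L] (hL : 2 ≤ L) :
    ∃ k β₀ : ℝ, ∀ β : ℝ, β₀ ≤ β → ∃ O : GaugeConfig 3 L FemtoTransferGap.SU2 → ℝ,
      IsPhys O ∧ (∀ U, |O U| ≤ 1) ∧ (∀ U, O (configPerm (Equiv.swap (0 : Fin 3) 1) U) = -O U) ∧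
        β ^ (-k / L) * TT.physTrace L β (2 * L) ≤ TT.insTrace L β O 1 := by
  obtain ⟨k, β₁, hβ₁, hgap⟩ := sheetTrial_dressed_gap L
  obtain ⟨C, q, hC, hZ⟩ := SwapTwistDeficit.physTrace_le_poly_mul_pow L (T := 2 * L) (by omega)
  set K : ℝ := ((2 * L - 1 : ℕ) : ℝ) * k + q + 1 with hK
  refine ⟨(L : ℝ) * K, max β₁ C, fun β hβ => ?_⟩
  have hββ₁ : β₁ ≤ β := (le_max_left _ _).trans hβ
  have hβC : C ≤ β := (le_max_right _ _).trans hβ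
  have hβ1 : 1 ≤ β := hβ₁.trans hββ₁
  have hβ0 : 0 < β := by linarith
  have hLpos : (0 : ℝ) < L := Nat.cast_pos.2 (Nat.pos_of_ne_zero (NeZero.ne L))
  -- the witness
  set S := configPerm (G := FemtoTransferGap.SU2) (L := L) (Equiv.swap (0 : Fin 3) 1) with hS
  set O : GaugeConfig 3 L FemtoTransferGap.SU2 → ℝ := fun U => sheetTrial U - sheetTrial (S U) with hO
  have hOP : IsPhys O := by
    have h := isPhys_sheetTrial.add ((isPhys_sheetTrial (L := L).comp_configPerm (Equiv.swap (0 : Fin 3) 1)).smul (-1))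
    have e : (sheetTrial + (-1 : ℝ) • fun U : GaugeConfig 3 L FemtoTransferGap.SU2 => sheetTrial (configPerm (Equiv.swap (0 : Fin 3) 1) U)) = O := by
      funext U; simp only [hO, hS, Pi.add_apply, Pi.smul_apply, smul_eq_mul]; ring
    rw [e] at h; exact h
  have hOb : ∀ U, |O U| ≤ 1 := fun U => by
    simp only [hO]
    rw [abs_le]
    exact ⟨by linarith [sheetTrial_nonneg U, sheetTrial_le_one (S U)], by linarith [sheetTrial_le_one U, sheetTrial_nonneg (S U)]⟩
  have hodd : ∀ U, O (S U) = -O U := fun U => by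
    simp only [hO, hS, TT.configPerm_swap_swap]; ring
  refine ⟨O, hOP, hOb, hodd, ?_⟩
  -- the dressed witness `h = O e^{-(β/2)S}`: norm in `(0, 1]`, energy `≥ β^{-k} c_β^{|E|}`
  set h : GaugeConfig 3 L FemtoTransferGap.SU2 → ℝ := fun U => O U * Real.exp (-(β / 2) * wilsonAction su2Rep U) with hh
  have hhP : IsPhys h := isPhys_mul_expAction β hOP
  set qh : ℝ := qform su2Rep β h h with hqh
  set n2 : ℝ := l2 h h with hn2
  have hq_ge : β ^ (-k) * latCE L β ≤ qh := by
    have := hgap β hββ₁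
    simp only [hqh, hh, hO, hS]
    exact this
  have hlat0 : 0 < latCE L β := latCE_pos hβ0.le
  have hs0 : 0 < β ^ (-k) * latCE L β := mul_pos (Real.rpow_pos_of_pos hβ0 _) hlat0
  have hq0 : 0 < qh := hs0.trans_le hq_ge
  have hn2_le : n2 ≤ 1 := by
    simp only [hn2]; unfold l2
    have hint := hhP.integrable_mul hhP
    calc ∫ U, h U * h U ∂configMeasure FemtoTransferGap.SU2 L ≤ ∫ _U, (1 : ℝ) ∂configMeasure FemtoTransferGap.SU2 L := by
          refine integral_mono hint (integrable_const 1) fun U => ?_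
          have hab : |h U| ≤ 1 := by
            simp only [hh]; rw [abs_mul, abs_of_pos (Real.exp_pos _)]
            exact mul_le_one₀ (hOb U) (Real.exp_pos _).le (expAction_le_one hβ0.le U)
          have := abs_le.1 hab
          nlinarith
      _ = 1 := by rw [integral_const, smul_eq_mul, mul_one, probReal_univ]
  have hn2_pos : 0 < n2 := by
    have hle : qh ≤ latCE L β * n2 := qform_le_latCE_mul_l2 hβ0.le hhP
    by_contra hcon
    push Not at hcon
    have : latCE L β * n2 ≤ 0 := mul_nonpos_of_nonneg_of_nonpos hlat0.le hcon
    linarith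
  -- the spectral floor
  have hfloor := TT.insTrace_one_ge hL hβ0 hOP hOb
  have hfloor' : latCE L β * qh ^ (2 * L - 1) ≤ TT.insTrace L β O 1 := by
    refine le_trans ?_ hfloor
    have hpow0 : 0 < n2 ^ (2 * L - 2) := pow_pos hn2_pos _
    have hpow1 : n2 ^ (2 * L - 2) ≤ 1 := pow_le_one₀ hn2_pos.le hn2_le
    exact le_div_self (mul_nonneg hlat0.le (pow_nonneg hq0.le _)) hpow0 hpow1
  -- `β^{-K} Z(2L) ≤ c_β^{|E|} q_h^{2L-1}`
  have hlam0 : 0 < levelValue su2Rep L β 0 := levelValue_zero_su2Rep_pos L β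
  have hlamCE : levelValue su2Rep L β 0 ≤ latCE L β := by rw [levelValue_zero]; exact topValue_le_latCE hβ0.le
  have hZβ := hZ β hβ1
  have hZ0 : 0 ≤ TT.physTrace L β (2 * L) :=
    (TT.traceFormula_all L β (2 * L) hβ1 (by omega)).nonneg fun j => pow_nonneg (levelValue_su2Rep_pos hβ0 j).le _
  have hmain : β ^ (-K) * TT.physTrace L β (2 * L) ≤ latCE L β * qh ^ (2 * L - 1) := by
    -- `β^{-K} = β^{-(2L-1)k} (β^q)⁻¹ β⁻¹`
    have e1 : β ^ (-K) = (β ^ (-k)) ^ (2 * L - 1) * (β ^ q)⁻¹ * β⁻¹ := by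
      rw [hK, show -(((2 * L - 1 : ℕ) : ℝ) * k + q + 1) = ((2 * L - 1 : ℕ) : ℝ) * (-k) + (-q) + (-1 : ℝ) by ring, Real.rpow_add hβ0,
        Real.rpow_add hβ0, Real.rpow_neg hβ0.le q, Real.rpow_neg_one, mul_comm (((2 * L - 1 : ℕ) : ℝ)) (-k), Real.rpow_mul hβ0.le,
        Real.rpow_natCast]
    rw [e1]
    have hβinv : β⁻¹ ≤ 1 / C := by rw [inv_le_comm₀ hβ0 (by positivity), inv_div, div_one]; exact hβC
    have hq0' : (β ^ q)⁻¹ * (C * β ^ q) = C := by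
      have : β ^ q ≠ 0 := (Real.rpow_pos_of_pos hβ0 q).ne'
      field_simp
    calc (β ^ (-k)) ^ (2 * L - 1) * (β ^ q)⁻¹ * β⁻¹ * TT.physTrace L β (2 * L)
        ≤ (β ^ (-k)) ^ (2 * L - 1) * (β ^ q)⁻¹ * (1 / C) * (C * β ^ q * levelValue su2Rep L β 0 ^ (2 * L)) := by
          refine mul_le_mul (mul_le_mul_of_nonneg_left hβinv (by positivity)) hZβ hZ0 (by positivity)
      _ = (β ^ (-k)) ^ (2 * L - 1) * levelValue su2Rep L β 0 ^ (2 * L) * ((β ^ q)⁻¹ * (C * β ^ q) * (1 / C)) := by ring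
      _ = (β ^ (-k)) ^ (2 * L - 1) * levelValue su2Rep L β 0 ^ (2 * L) := by rw [hq0']; field_simp
      _ = levelValue su2Rep L β 0 * (β ^ (-k) * levelValue su2Rep L β 0) ^ (2 * L - 1) := by
          rw [mul_pow, show levelValue su2Rep L β 0 ^ (2 * L) = levelValue su2Rep L β 0 * levelValue su2Rep L β 0 ^ (2 * L - 1) by
            rw [← pow_succ']; congr 1; omega]
          ring
      _ ≤ latCE L β * qh ^ (2 * L - 1) := by
          refine mul_le_mul hlamCE (pow_le_pow_left₀ (by positivity) ?_ _) (by positivity) hlat0.le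
          exact (mul_le_mul_of_nonneg_left hlamCE (Real.rpow_nonneg hβ0.le _)).trans hq_ge
  have hexpo : -((L : ℝ) * K) / L = -K := by field_simp
  rw [hexpo]
  exact hmain.trans hfloor'

/-- The rung is literally the fixed-`L` slice of `StepPersistence`'s conclusion (same shape, the window hypotheses unused). -/
theorem stepPersistence_rung_fixedL_shape (L : ℕ) [NeZero L] (hL : 2 ≤ L) :
    ∃ k β₀ : ℝ, ∀ β : ℝ, β₀ ≤ β → ∀ A : ℝ, 0 < A → ((L : ℕ) : ℝ) ≤ β ^ A → ∃ O : GaugeConfig 3 L FemtoTransferGap.SU2 → ℝ,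
      IsPhys O ∧ (∀ U, |O U| ≤ 1) ∧ (∀ U, O (configPerm (Equiv.swap (0 : Fin 3) 1) U) = -O U) ∧
        β ^ (-k / L) * TT.physTrace L β (2 * L) ≤ TT.insTrace L β O 1 := by
  obtain ⟨k, β₀, h⟩ := stepPersistence_rung_fixedL L hL
  exact ⟨k, β₀, fun β hβ _ _ _ => h β hβ⟩

end Summit.QuantumFields.YangMills.Theorems.SlowBitWindow

end
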